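import Summits.QuantumAdvantage.AdviceFreeQNC0.AffBells26MoveSystems
import HarnessLib

/-!
# `CubeTargetEven` PROVED (qn-lit g27, for ask P-27d of qn-p1 g27 / ROUND-26 §6)

HOME sketch (literature seat; a prover lands it).  v2: imports the LANDED `AffBells26MoveSystems` (P-26b, 2026-08-28T16:16Z) and uses its
`xF`, `MoveSystem`, `cubeTargetSum`, `CubeTargetGen`; only `CubeTargetEven` (VERBATIM from `HOME/qa-qnc0-p1/exp27/Sketch27.lean` §27.1, not yet
in the tree) is declared here, in the namespace `AffBells27lit` so that nothing clashes with a later port.  Results: `owned_separated`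
(the distance hypothesis of the landed `AffBells26.CubeTargetGen` FOLLOWS from `MoveSystem`), `cubeTargetGen : AffBells26.CubeTargetGen`
(the landed statement), and the hypothesis-free `cubeTargetEven : CubeTargetEven` (all `N`, all `m ≥ 2`).

Proof (LIT-MEMO-36 §3):
* **3-separation of owned sets** (`nxt_nxt_not_mem_of_mem`): in a move system, if `a ∈ O j` then `a+2 ∉ O j'` for `j' ≠ j`
  — from `Fib19.kline_hardCore` (no two adjacent zeros on any kernel line of the cube), the kernel equation
  `Fib19.apply_eq_of_kline` at `a+1`, and disjointness of the flip sets;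
* **parity bookkeeping**: `Σ_S N`, `Σ_S zeros(J_S)`, `Σ_S pairs2(J_S)` are even — for every position `i` some move `j₀`
  owns neither `i` nor `i+2`, and `S ↦ S ∆ {j₀}` is an involution of the relevant sets of subsets switching `j₀ ∈ S`
  (`Fib19.two_mul_card_filter_of_invol`).
Data (kit j312006, second lineage): 429 377 move systems, 0 odd target sums.  Separation NOT moved.
-/

namespace Summit.QuantumAdvantage.AdviceFreeQNC0

namespace AffBells27lit

open Finset Literature.Computability.QuantumComplexity Literature.Computability.QuantumComplexity.RingHLF
open AffBells23 Fib19 AffBells26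

/-! ## The statement (verbatim Sketch27 §27.1; `xF`, `MoveSystem`, `cubeTargetSum` are the landed `AffBells26` ones) -/

/-- Hypothesis-free cube target lemma (planner qn-p1 g27, Sketch27 §27.1, verbatim). -/
def CubeTargetEven : Prop :=
  ∀ N m : ℕ, 2 ≤ m → ∀ (x : Fin N → Bool) (F O : Fin m → Finset (Fin N)), MoveSystem x F O → cubeTargetSum x F % 2 = 0

/-! ## Small tools -/

/-- `decide` respects `↔`. -/
private theorem decide_congr_iff {P Q : Prop} [Decidable P] [Decidable Q] (h : P ↔ Q) : decide P = decide Q := by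
  by_cases hQ : Q
  · rw [decide_eq_true (h.2 hQ), decide_eq_true hQ]
  · rw [decide_eq_false (fun hP => hQ (h.1 hP)), decide_eq_false hQ]

/-- With `m ≥ 2` moves there is a move different from a given one. -/
theorem exists_ne_of_two_le {m : ℕ} (hm : 2 ≤ m) (j : Fin m) : ∃ j₀ : Fin m, j₀ ≠ j := by
  by_cases h : j.val = 0
  · exact ⟨⟨1, by omega⟩, fun e => by have := congrArg Fin.val e; simp only at this; omega⟩
  · exact ⟨⟨0, by omega⟩, fun e => by have := congrArg Fin.val e; simp only at this; omega⟩

/-- For `N ≤ 2` the position `i + 2` is `i` itself. -/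
theorem nxt_nxt_eq_self_of_lt_three {N : ℕ} (hN : ¬ 3 ≤ N) (i : Fin N) : nxt (nxt i) = i := by
  apply Fin.ext
  have hi := i.isLt
  simp only [nxt]
  have hN' : N = 1 ∨ N = 2 := by omega
  rcases hN' with rfl | rfl
  · omega
  · have : i.val = 0 ∨ i.val = 1 := by omega
    rcases this with h | h <;> simp [h]

/-- A subset family closed under toggling `j₀` has even size (toggling switches `j₀ ∈ S`). -/
theorem card_filter_even_of_toggle {m : ℕ} (j₀ : Fin m) (p : Finset (Fin m) → Prop) [DecidablePred p]
    (hp : ∀ S, p (symmDiff S {j₀}) ↔ p S) : ((univ : Finset (Finset (Fin m))).filter p).card % 2 = 0 := by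
  have h := two_mul_card_filter_of_invol ((univ : Finset (Finset (Fin m))).filter p) (fun S => j₀ ∈ S)
    (fun S => symmDiff S {j₀})
    (fun S hS => by
      rw [mem_filter] at hS ⊢
      exact ⟨mem_univ _, (hp S).2 hS.2⟩)
    (fun S _ => symmDiff_symmDiff_cancel_right {j₀} S)
    (fun S _ => by simp [Finset.mem_symmDiff])
  omega

/-- Toggling a move that does not own `i` does not change whether some move of `S` owns `i`. -/
theorem exists_mem_symmDiff_iff {m N : ℕ} (O : Fin m → Finset (Fin N)) (S : Finset (Fin m)) {j₀ : Fin m}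
    {i : Fin N} (hi : i ∉ O j₀) : (∃ j ∈ symmDiff S {j₀}, i ∈ O j) ↔ (∃ j ∈ S, i ∈ O j) := by
  constructor
  · rintro ⟨j, hj, hij⟩
    have hne : j ≠ j₀ := by rintro rfl; exact hi hij
    rw [Finset.mem_symmDiff, mem_singleton] at hj
    rcases hj with ⟨h, -⟩ | ⟨h, -⟩
    · exact ⟨j, h, hij⟩
    · exact absurd h hne
  · rintro ⟨j, hj, hij⟩
    have hne : j ≠ j₀ := by rintro rfl; exact hi hij
    exact ⟨j, Finset.mem_symmDiff.2 (Or.inl ⟨hj, by rwa [mem_singleton]⟩), hij⟩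

/-! ## Kernel lines along a move system -/

section MoveSystem

variable {N m : ℕ} {x : Fin N → Bool} {F O : Fin m → Finset (Fin N)}

/-- The kernel line of `x_S` at a position owned by `jj`: `J_i ⊕ [jj ∈ S]`. -/
theorem kline_xF_of_mem (hM : MoveSystem x F O) (S : Finset (Fin m)) {i : Fin N} {jj : Fin m}
    (hi : i ∈ O jj) : kline (xF x F S) i = xor (kline x i) (decide (jj ∈ S)) := by
  rw [(hM.2.1 S).2 i]
  congr 1
  apply decide_congr_iff
  constructor
  · rintro ⟨j, hj, hij⟩
    by_cases hjj : j = jj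
    · exact hjj ▸ hj
    · exact absurd hi (disjoint_left.1 (hM.2.2.1 j jj hjj).2 hij)
  · exact fun h => ⟨jj, h, hi⟩

/-- The kernel line of `x_S` at a position owned by no move of `S`: `J_i`. -/
theorem kline_xF_of_forall_not_mem (hM : MoveSystem x F O) (S : Finset (Fin m)) {i : Fin N}
    (hi : ∀ j ∈ S, i ∉ O j) : kline (xF x F S) i = kline x i := by
  rw [(hM.2.1 S).2 i]
  have : decide (∃ j ∈ S, i ∈ O j) = false := decide_eq_false (fun ⟨j, hj, hij⟩ => hi j hj hij)
  rw [this, Bool.xor_false]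

/-- Toggling a move owning neither `i` keeps the kernel-line value at `i`. -/
theorem kline_xF_symmDiff (hM : MoveSystem x F O) (S : Finset (Fin m)) {j₀ : Fin m} {i : Fin N}
    (hi : i ∉ O j₀) : kline (xF x F (symmDiff S {j₀})) i = kline (xF x F S) i := by
  rw [(hM.2.1 _).2 i, (hM.2.1 S).2 i, decide_congr_iff (exists_mem_symmDiff_iff O S hi)]

/-- No two adjacent zeros on the kernel line of any cube point (`Fib19.kline_hardCore`). -/
theorem not_adjacent_zeros (hN : 3 ≤ N) (hM : MoveSystem x F O) (S : Finset (Fin m)) (i : Fin N) :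
    ¬ (kline (xF x F S) i = false ∧ kline (xF x F S) (nxt i) = false) :=
  (kline_hardCore hN (xF x F S) (hM.2.1 S).1).1 i

/-- **3-SEPARATION OF OWNED SETS**: a position two steps after a position owned by `j` is not owned by another
move `j'`. -/
theorem nxt_nxt_not_mem_of_mem (hN : 3 ≤ N) (hM : MoveSystem x F O) {j j' : Fin m} (hjj : j ≠ j')
    {a : Fin N} (ha : a ∈ O j) : nxt (nxt a) ∉ O j' := by
  intro hc
  set b := nxt a with hb
  set c := nxt b with hcdef
  have hdisjO : Disjoint (O j) (O j') := (hM.2.2.1 j j' hjj).2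
  have hdisjF : Disjoint (F j) (F j') := (hM.2.2.1 j j' hjj).1
  have ha' : a ∉ O j' := disjoint_left.1 hdisjO ha
  have hc' : c ∉ O j := fun h => disjoint_left.1 hdisjO h hc
  -- kernel-line values at a and c along the four subsets of {j, j'}
  have hKa : ∀ S : Finset (Fin m), kline (xF x F S) a = xor (kline x a) (decide (j ∈ S)) :=
    fun S => kline_xF_of_mem hM S ha
  have hKc : ∀ S : Finset (Fin m), kline (xF x F S) c = xor (kline x c) (decide (j' ∈ S)) :=
    fun S => kline_xF_of_mem hM S hc
  have hj'j : j' ≠ j := fun h => hjj h.symm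
  by_cases hbj : b ∈ O j
  · -- b owned by j: choose [j ∈ S] = J b (so that K_S b = false) and [j' ∈ S] = J c (so that K_S c = false)
    have hKb : ∀ S : Finset (Fin m), kline (xF x F S) b = xor (kline x b) (decide (j ∈ S)) :=
      fun S => kline_xF_of_mem hM S hbj
    let S : Finset (Fin m) := (if kline x b then {j} else ∅) ∪ (if kline x c then {j'} else ∅)
    apply not_adjacent_zeros hN hM S b
    refine ⟨?_, ?_⟩
    · rw [hKb S]
      cases hxb : kline x b <;> cases hxc : kline x c <;> simp [S, hxb, hxc, hjj]
    · rw [← hcdef, hKc S]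
      cases hxc : kline x c <;> cases hxb : kline x b <;> simp [S, hxb, hxc, hj'j]
  by_cases hbj' : b ∈ O j'
  · -- b owned by j': make K_S a = false and K_S b = false
    have hKb : ∀ S : Finset (Fin m), kline (xF x F S) b = xor (kline x b) (decide (j' ∈ S)) :=
      fun S => kline_xF_of_mem hM S hbj'
    let S : Finset (Fin m) := (if kline x a then {j} else ∅) ∪ (if kline x b then {j'} else ∅)
    apply not_adjacent_zeros hN hM S a
    refine ⟨?_, ?_⟩
    · rw [hKa S]
      cases hxa : kline x a <;> cases hxb : kline x b <;> simp [S, hxa, hxb, hjj]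
    · rw [← hb, hKb S]
      cases hxb : kline x b <;> cases hxa : kline x a <;> simp [S, hxb, hxa, hj'j]
  · -- b owned by neither j nor j': K_S b = J b along the subsets of {j, j'}
    have hKb : ∀ S : Finset (Fin m), (∀ j'' ∈ S, j'' = j ∨ j'' = j') → kline (xF x F S) b = kline x b := by
      intro S hS
      apply kline_xF_of_forall_not_mem hM S
      intro j'' hj'' hb''
      rcases hS j'' hj'' with rfl | rfl
      · exact hbj hb''
      · exact hbj' hb''
    cases hxb : kline x b
    · -- J b = false: make K_S a = false
      let S : Finset (Fin m) := if kline x a then {j} else ∅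
      apply not_adjacent_zeros hN hM S a
      refine ⟨?_, ?_⟩
      · rw [hKa S]
        cases hxa : kline x a <;> simp [S, hxa]
      · rw [← hb, hKb S (by intro j'' hj''; cases hxa : kline x a <;> simp_all [S]), hxb]
    · -- J b = true: the kernel equation at b forces x_S b = K_S a ⊕ K_S c, so b would be flipped by j AND by j'
      have hxS : ∀ S : Finset (Fin m), (∀ j'' ∈ S, j'' = j ∨ j'' = j') →
          xF x F S b = xor (xor (kline x a) (decide (j ∈ S))) (xor (kline x c) (decide (j' ∈ S))) := by
        intro S hS
        have h := apply_eq_of_kline hN (xF x F S) (hM.2.1 S).1 b (by rw [hKb S hS, hxb])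
        rw [h, hb, prv_nxt, ← hb, ← hcdef, hKa S, hKc S]
      have h0 := hxS ∅ (by simp)
      have h1 := hxS {j} (by simp)
      have h2 := hxS {j'} (by simp)
      simp only [xF, Finset.notMem_empty, decide_false, Bool.xor_false, biUnion_empty, mem_singleton,
        decide_true, singleton_biUnion, hjj, hj'j] at h0 h1 h2
      -- h0 : flipAt x ∅ b = J a ⊕ J c ; h1 : flipAt x (F j) b = (J a ⊕ 1) ⊕ J c ; h2 : flipAt x (F j') b = J a ⊕ (J c ⊕ 1)
      have hbFj : b ∈ F j := by
        by_contra hnot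
        rw [flipAt_apply_of_not_mem hnot] at h1
        rw [flipAt_apply_of_not_mem (Finset.notMem_empty b)] at h0
        rw [h0] at h1
        revert h1; cases kline x a <;> cases kline x c <;> decide
      have hbFj' : b ∈ F j' := by
        by_contra hnot
        rw [flipAt_apply_of_not_mem hnot] at h2
        rw [flipAt_apply_of_not_mem (Finset.notMem_empty b)] at h0
        rw [h0] at h2
        revert h2; cases kline x a <;> cases kline x c <;> decide
      exact disjoint_left.1 hdisjF hbFj hbFj'

/-- Adjacent positions are never owned by two different moves (hard-core kernel lines along the cube). -/
theorem nxt_not_mem_of_mem (hN : 3 ≤ N) (hM : MoveSystem x F O) {j j' : Fin m} (hjj : j ≠ j')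
    {a : Fin N} (ha : a ∈ O j) : nxt a ∉ O j' := by
  intro hb
  have hj'j : j' ≠ j := fun h => hjj h.symm
  have hKa : ∀ S : Finset (Fin m), kline (xF x F S) a = xor (kline x a) (decide (j ∈ S)) :=
    fun S => kline_xF_of_mem hM S ha
  have hKb : ∀ S : Finset (Fin m), kline (xF x F S) (nxt a) = xor (kline x (nxt a)) (decide (j' ∈ S)) :=
    fun S => kline_xF_of_mem hM S hb
  let S : Finset (Fin m) := (if kline x a then {j} else ∅) ∪ (if kline x (nxt a) then {j'} else ∅)
  apply not_adjacent_zeros hN hM S a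
  refine ⟨?_, ?_⟩
  · rw [hKa S]
    cases hxa : kline x a <;> cases hxb : kline x (nxt a) <;> simp [S, hxa, hxb, hjj]
  · rw [hKb S]
    cases hxb : kline x (nxt a) <;> cases hxa : kline x a <;> simp [S, hxb, hxa, hj'j]

/-- **The distance hypothesis of the landed `AffBells26.CubeTargetGen` holds for every move system** (`N ≥ 3`): owned sets of
different moves are at cyclic distance `≥ 3`. -/
theorem owned_separated (hN : 3 ≤ N) (hM : MoveSystem x F O) :
    ∀ j j' : Fin m, j ≠ j' → ∀ u ∈ O j, ∀ v ∈ O j', v ≠ nxt (nxt u) ∧ v ≠ nxt u := by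
  intro j j' hjj u hu v hv
  exact ⟨fun h => nxt_nxt_not_mem_of_mem hN hM hjj hu (h ▸ hv), fun h => nxt_not_mem_of_mem hN hM hjj hu (h ▸ hv)⟩

/-- For every position `i` some move owns neither `i` nor `i + 2` (needs `m ≥ 2`). -/
theorem exists_free_move (hm : 2 ≤ m) (hM : MoveSystem x F O) (i : Fin N) :
    ∃ j₀ : Fin m, i ∉ O j₀ ∧ nxt (nxt i) ∉ O j₀ := by
  have hm0 : 0 < m := by omega
  by_cases hi : ∃ j, i ∈ O j
  · obtain ⟨j, hij⟩ := hi
    obtain ⟨j₀, hj₀⟩ := exists_ne_of_two_le hm j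
    have hdisj : Disjoint (O j₀) (O j) := (hM.2.2.1 j₀ j hj₀).2
    refine ⟨j₀, fun h => disjoint_left.1 hdisj h hij, fun hc => ?_⟩
    by_cases hN : 3 ≤ N
    · exact nxt_nxt_not_mem_of_mem hN hM (Ne.symm hj₀) hij hc
    · rw [nxt_nxt_eq_self_of_lt_three hN] at hc
      exact disjoint_left.1 hdisj hc hij
  · push Not at hi
    by_cases hc : ∃ j', nxt (nxt i) ∈ O j'
    · obtain ⟨j', hcj'⟩ := hc
      obtain ⟨j₀, hj₀⟩ := exists_ne_of_two_le hm j'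
      have hdisj : Disjoint (O j₀) (O j') := (hM.2.2.1 j₀ j' hj₀).2
      exact ⟨j₀, hi j₀, fun h => disjoint_left.1 hdisj h hcj'⟩
    · push Not at hc
      exact ⟨⟨0, hm0⟩, hi _, hc _⟩

/-! ## The parity bookkeeping -/

/-- `Σ_S zeros (J_S)` is even. -/
theorem sum_zeros_even (hm : 2 ≤ m) (hM : MoveSystem x F O) :
    (∑ S : Finset (Fin m), zeros (kline (xF x F S))) % 2 = 0 := by
  have hswap : ∑ S : Finset (Fin m), zeros (kline (xF x F S))
      = ∑ i : Fin N, ((univ : Finset (Finset (Fin m))).filter fun S => kline (xF x F S) i = false).card := by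
    simp only [zeros, card_filter]
    exact Finset.sum_comm
  have h0 : ∀ i ∈ (univ : Finset (Fin N)),
      ((univ : Finset (Finset (Fin m))).filter fun S => kline (xF x F S) i = false).card % 2 = 0 := by
    intro i _
    obtain ⟨j₀, hi, -⟩ := exists_free_move hm hM i
    exact card_filter_even_of_toggle j₀ _ fun S => by rw [kline_xF_symmDiff hM S hi]
  rw [hswap, Finset.sum_nat_mod, Finset.sum_eq_zero h0]
  exact Nat.zero_mod 2

/-- `Σ_S pairs2 (J_S)` is even. -/
theorem sum_pairs2_even (hm : 2 ≤ m) (hM : MoveSystem x F O) :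
    (∑ S : Finset (Fin m), pairs2 (kline (xF x F S))) % 2 = 0 := by
  have hswap : ∑ S : Finset (Fin m), pairs2 (kline (xF x F S))
      = ∑ i : Fin N, ((univ : Finset (Finset (Fin m))).filter fun S =>
          kline (xF x F S) i = false ∧ kline (xF x F S) (nxt (nxt i)) = false).card := by
    simp only [pairs2, card_filter]
    exact Finset.sum_comm
  have h0 : ∀ i ∈ (univ : Finset (Fin N)),
      ((univ : Finset (Finset (Fin m))).filter fun S =>
        kline (xF x F S) i = false ∧ kline (xF x F S) (nxt (nxt i)) = false).card % 2 = 0 := by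
    intro i _
    obtain ⟨j₀, hi, hc⟩ := exists_free_move hm hM i
    exact card_filter_even_of_toggle j₀ _ fun S => by rw [kline_xF_symmDiff hM S hi, kline_xF_symmDiff hM S hc]
  rw [hswap, Finset.sum_nat_mod, Finset.sum_eq_zero h0]
  exact Nat.zero_mod 2

/-- `Σ_S N = 2^m · N` is even. -/
theorem sum_const_even (hm : 2 ≤ m) (N : ℕ) : (∑ _S : Finset (Fin m), N) % 2 = 0 := by
  rw [sum_const, card_univ, Fintype.card_finset, Fintype.card_fin, smul_eq_mul]
  obtain ⟨m', rfl⟩ : ∃ m', m = m' + 1 := ⟨m - 1, by omega⟩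
  rw [pow_succ, mul_assoc, mul_left_comm]
  exact Nat.mul_mod_right 2 _

end MoveSystem

/-! ## The theorem -/

/-- **`CubeTargetEven` holds**: along every move system with `m ≥ 2` moves the cube target sum is even (all `N`). -/
theorem cubeTargetEven : CubeTargetEven := by
  intro N m hm x F O hM
  unfold cubeTargetSum
  rw [sum_add_distrib, sum_add_distrib, Nat.add_mod, Nat.add_mod (∑ _S : Finset (Fin m), N),
    sum_const_even hm N, sum_zeros_even hm hM, sum_pairs2_even hm hM]

/- NOTE (landing prover qn-prover-3 g14): the file's closing `theorem cubeTargetGen : CubeTargetGen` is omitted here — the landed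
`AffBells26.cubeTargetGen` (AffBells26CubeTargetGen.lean, p648524) is the same statement (gate dedup); `owned_separated` above shows its
distance hypothesis is automatic. -/

end AffBells27lit

end Summit.QuantumAdvantage.AdviceFreeQNC0
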